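import Summits.AtomisticToContinuum.HydrodynamicLimit.Theorems.InformationPercolationEnginePercolationClosesChaosCesaroStaticAssembly
import HarnessLib

/-!
# Local equilibrium S5 of the line `equilibrium-forecast-chain-rule` (crux `InformationPercolationEngine.PercolationClosesChaos`,
stmt-AtomisticToContinuum-15178) — piece C′: the fixed-`N` assembly of `CoarseLocalMaxwellianity` from a static rarity bound
WITH AN OCCUPANCY FLOOR

Support file (`--supports stmt-AtomisticToContinuum-15178`) of the registered stub (skeleton v5 of lead c3)
`stub_cesaroLocalEquilibrium : MesoStaticMaxwellRarity → LocalCountUI → NoKineticIrregularity → CoarseLocalMaxwellianity`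
(worker W4). It is the floor version of piece C (`…CesaroStaticAssembly.lean`, `lintegral_nonMaxwellian_le`): the re-typed
static rarity statement `MesoStaticMaxwellRarity` counts only REGULAR cells holding AT LEAST `m₀` spheres, so the pointwise split
of the `CoarseLocalMaxwellianity` integrand acquires a fourth family, the occupied UNDER-POPULATED cells (`pop.Nonempty ∧
card < m₀`, kinetic rarefaction — paid on the `LG` side by `NoKineticIrregularity`):

  `𝟙{occupied ∧ ϑ < relEnt} ≤ 𝟙{Regular ∧ m₀ ≤ card ∧ ϑ ≤ relEnt} + 𝟙{occupied ∧ Dense} + 𝟙{occupied ∧ ϑh < inhom}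
    + 𝟙{occupied ∧ card < m₀}`.

* `measurableSet_le_card_pop`, `measurableSet_card_pop_lt` — the occupancy events are measurable (functions of the cell pattern,
  `measurable_of_cellPattern` of piece M);
* `clmIndicatorFloor_le` — the pointwise split above (extends `clmIndicator_le`);
* `lintegral_nonMaxwellian_floor_le` (registered helper, the headline) — for probability laws `μ` (evolved), `ν` (reference) with
  `KL(μ‖ν) ≤ A(N+1)`: `ν{δ' < unitAvg 𝟙{Regular ∧ m₀ ≤ card ∧ ϑ ≤ relEntAt}} ≤ e^{-L(N+1)}`,
  `∫⁻ unitAvg 𝟙{occupied ∧ Dense} dμ ≤ δ₁`, `∫⁻ unitAvg 𝟙{occupied ∧ ϑh < inhom} dμ ≤ δ₂`,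
  `∫⁻ unitAvg 𝟙{occupied ∧ card < m₀} dμ ≤ δ₃` ⇒
  `∫⁻ unitAvg 𝟙{occupied ∧ ϑ < relEntAt} dμ ≤ ofReal (δ' + 27 (log 2 + A)/L) + δ₁ + δ₂ + δ₃`
  (entropy-inequality transfer `lintegral_ofReal_le_of_measure_le_exp` of piece T′ for the first family, which is bounded by
  `27` on a mesh `cℓ_N ≤ 1`; additivity / monotonicity of unit averages of box-supported families for the rest).
-/

noncomputable section

open MeasureTheory Set Filter Topology
open scoped ENNReal BigOperators Classical
open Literature.Analysis.FluidPDE Literature.MathematicalPhysics.KineticTheory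
open Literature.MathematicalPhysics.KineticTheory.VelocityBlindPlacement

namespace Summit.AtomisticToContinuum.HydrodynamicLimit.Theorems.EquilibriumForecastLine

variable {σ : ℝ} {N : ℕ}

/-! ## The occupancy events -/

/-- The event "cell `q` holds at least `m₀` spheres" is measurable (a function of the cell pattern). [folklore] -/
theorem measurableSet_le_card_pop (c σ : ℝ) (m₀ : ℕ) (q : Cell) :
    MeasurableSet {w : Phase N | m₀ ≤ (pop c σ N w q).card} := by
  have h : Measurable fun w : Phase N => m₀ ≤ (pop c σ N w q).card :=
    measurable_of_cellPattern c σ (g := fun π _ => m₀ ≤ (Finset.univ.filter fun i => π i = q).card)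
      fun _ => measurable_const
  exact measurableSet_setOf.2 h

/-- The event "cell `q` holds fewer than `m₀` spheres" is measurable (a function of the cell pattern). [folklore] -/
theorem measurableSet_card_pop_lt (c σ : ℝ) (m₀ : ℕ) (q : Cell) :
    MeasurableSet {w : Phase N | (pop c σ N w q).card < m₀} := by
  have h : Measurable fun w : Phase N => (pop c σ N w q).card < m₀ :=
    measurable_of_cellPattern c σ (g := fun π _ => (Finset.univ.filter fun i => π i = q).card < m₀)
      fun _ => measurable_const
  exact measurableSet_setOf.2 h

/-! ## The pointwise split with the floor -/

/-- **The pointwise split of the `CoarseLocalMaxwellianity` indicator with an occupancy floor `m₀`**: occupied ∧ non-Maxwellian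
≤ (regular ∧ at least `m₀` spheres ∧ non-Maxwellian) + (occupied ∧ packed) + (occupied ∧ inhomogeneous) +
(occupied ∧ fewer than `m₀` spheres). [folklore] -/
theorem clmIndicatorFloor_le (ϑs ϑ ϑh φs c : ℝ) (m₀ : ℕ) (w : Phase N) (q : Cell) (e : ℝ) :
    (if (pop c σ N w q).Nonempty ∧ ϑ < e then (1 : ℝ) else 0) ≤
      (if Regular ϑs ϑh φs c σ N w q ∧ m₀ ≤ (pop c σ N w q).card ∧ ϑ ≤ e then (1 : ℝ) else 0) +
        (if (pop c σ N w q).Nonempty ∧ Dense φs c σ N w q then (1 : ℝ) else 0) +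
        (if (pop c σ N w q).Nonempty ∧ ϑh < inhom ϑs w (pop c σ N w q) (nbhd c σ N w q) then (1 : ℝ) else 0) +
        (if (pop c σ N w q).Nonempty ∧ (pop c σ N w q).card < m₀ then (1 : ℝ) else 0) := by
  have h1 : (0 : ℝ) ≤ (if Regular ϑs ϑh φs c σ N w q ∧ m₀ ≤ (pop c σ N w q).card ∧ ϑ ≤ e then (1 : ℝ) else 0) := by
    positivity
  have h2 : (0 : ℝ) ≤ (if (pop c σ N w q).Nonempty ∧ Dense φs c σ N w q then (1 : ℝ) else 0) := by positivity
  have h3 : (0 : ℝ) ≤ (if (pop c σ N w q).Nonempty ∧ ϑh < inhom ϑs w (pop c σ N w q) (nbhd c σ N w q)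
      then (1 : ℝ) else 0) := by positivity
  have h4 : (0 : ℝ) ≤ (if (pop c σ N w q).Nonempty ∧ (pop c σ N w q).card < m₀ then (1 : ℝ) else 0) := by positivity
  by_cases h : (pop c σ N w q).Nonempty ∧ ϑ < e
  · rw [if_pos h]
    obtain ⟨hne, hlt⟩ := h
    by_cases hD : Dense φs c σ N w q
    · have e2 : (if (pop c σ N w q).Nonempty ∧ Dense φs c σ N w q then (1 : ℝ) else 0) = 1 := if_pos ⟨hne, hD⟩
      linarith
    · by_cases hI : ϑh < inhom ϑs w (pop c σ N w q) (nbhd c σ N w q)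
      · have e3 : (if (pop c σ N w q).Nonempty ∧ ϑh < inhom ϑs w (pop c σ N w q) (nbhd c σ N w q)
            then (1 : ℝ) else 0) = 1 := if_pos ⟨hne, hI⟩
        linarith
      · by_cases hC : (pop c σ N w q).card < m₀
        · have e4 : (if (pop c σ N w q).Nonempty ∧ (pop c σ N w q).card < m₀ then (1 : ℝ) else 0) = 1 :=
            if_pos ⟨hne, hC⟩
          linarith
        · have hR : Regular ϑs ϑh φs c σ N w q := ⟨hD, not_lt.1 hI⟩
          have e1 : (if Regular ϑs ϑh φs c σ N w q ∧ m₀ ≤ (pop c σ N w q).card ∧ ϑ ≤ e then (1 : ℝ) else 0) = 1 :=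
            if_pos ⟨hR, not_lt.1 hC, hlt.le⟩
          linarith
  · rw [if_neg h]
    linarith

/-! ## The fixed-`N` assembly with the floor -/

/-- **Registered helper `lintegral_nonMaxwellian_floor_le` (piece C′ of S5, Option C of the S5 audit with the occupancy floor of
`MesoStaticMaxwellRarity`): `CoarseLocalMaxwellianity` at fixed `N` from a static rarity bound with a floor.** For probability laws
`μ` (evolved) and `ν` (reference) on the phase space with `KL(μ‖ν) ≤ A(N+1)`, cell size `0 < h ≤ 1`, thresholds `ϑ > 0`, `ϑh`,
`φs`, a floor `m₀ : ℕ`, and `δ' ≥ 0`, `L > 0`: if under `ν` the unit-fraction of REGULAR `ϑ`-non-Maxwellian cells holding at least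
`m₀` spheres exceeds `δ'` only with probability `≤ e^{-L(N+1)}`, and under `μ` the unit-fractions of occupied packed cells, of
occupied `ϑh`-inhomogeneous cells and of occupied cells holding fewer than `m₀` spheres have expectation `≤ δ₁`, `≤ δ₂`, `≤ δ₃`,
then the `μ`-expectation of the unit-fraction of occupied `ϑ`-non-Maxwellian cells is `≤ δ' + 27 (log 2 + A)/L + δ₁ + δ₂ + δ₃`.
[folklore] -/
theorem lintegral_nonMaxwellian_floor_le : ∀ {σ : ℝ} {N : ℕ} (Φ : Flow σ N) (μ ν : Measure (Phase N)) [IsProbabilityMeasure μ] [IsProbabilityMeasure ν] (ϑs ϑh φs : ℝ) (m₀ : ℕ) {ϑ c τ δ' A L : ℝ} {δ₁ δ₂ δ₃ : ℝ≥0∞}, 0 < c * meanFreePath σ N → c * meanFreePath σ N ≤ 1 → 0 < ϑ → 0 ≤ δ' → 0 ≤ A → 0 < L → InformationTheory.klDiv μ ν ≤ ENNReal.ofReal (A * ((N : ℝ) + 1)) → ν {z | δ' < unitAvg c σ N τ fun k q => if Regular ϑs ϑh φs c σ N (Φ.flow ((k : ℝ) * stepLen c σ N) z) q ∧ m₀ ≤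 (pop c σ N (Φ.flow ((k : ℝ) * stepLen c σ N) z) q).card ∧ ϑ ≤ relEntAt ϑs c σ N Φ ((k : ℝ) * stepLen c σ N) q z then 1 else 0} ≤ ENNReal.ofReal (Real.exp (-(L * ((N : ℝ) + 1)))) → ∫⁻ z, ENNReal.ofReal (unitAvg c σ N τ fun k q => if (pop c σ N (Φ.flow ((k : ℝ) * stepLen c σ N) z) q).Nonempty ∧ Dense φs c σ N (Φ.flow ((k : ℝ) * stepLen c σ N) z) q then 1 else 0) ∂μ ≤ δ₁ → ∫⁻ z, ENNReal.ofReal (unitAvg c σ N τ fun k q => if (pop c σ N (Φ.flow ((k : ℝ) * stepLen c σ N) z) q).Nonempty ∧ ϑh < inhom ϑs (Φ.flow ((k : ℝ) * stepLen c σ N) z) (pop c σ N (Φ.flow ((k : ℝ) * stepLen c σ N) z) q) (nbhd c σ N (Φ.flow ((k : ℝ) * stepLen c σ N) z) q) then 1 else 0) ∂μ ≤ δ₂ → ∫⁻ z, ENNReal.ofReal (unitAvg c σ N τ fun k q => if (pop c σ N (Φ.flow ((k : ℝ) * stepLen c σ N) z) q).Nonempty ∧ (pop c σ N (Φ.flow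 ((k : ℝ) * stepLen c σ N) z) q).card < m₀ then 1 else 0) ∂μ ≤ δ₃ → ∫⁻ z, ENNReal.ofReal (unitAvg c σ N τ fun k q => if (pop c σ N (Φ.flow ((k : ℝ) * stepLen c σ N) z) q).Nonempty ∧ ϑ < relEntAt ϑs c σ N Φ ((k : ℝ) * stepLen c σ N) q z then 1 else 0) ∂μ ≤ ENNReal.ofReal (δ' + 27 * ((Real.log 2 + A) / L)) + δ₁ + δ₂ + δ₃ := by
  intro σ N Φ μ ν _ _ ϑs ϑh φs m₀ ϑ c τ δ' A L δ₁ δ₂ δ₃ h0 h1 hϑ hδ' hA hL hKL hν hD hI hC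
  -- the four families and their box support
  set FR : Phase N → ℝ := fun z => unitAvg c σ N τ fun k q =>
    if Regular ϑs ϑh φs c σ N (Φ.flow ((k : ℝ) * stepLen c σ N) z) q ∧
      m₀ ≤ (pop c σ N (Φ.flow ((k : ℝ) * stepLen c σ N) z) q).card ∧
      ϑ ≤ relEntAt ϑs c σ N Φ ((k : ℝ) * stepLen c σ N) q z then (1 : ℝ) else 0 with hFR
  set FD : Phase N → ℝ := fun z => unitAvg c σ N τ fun k q =>
    if (pop c σ N (Φ.flow ((k : ℝ) * stepLen c σ N) z) q).Nonempty ∧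
      Dense φs c σ N (Φ.flow ((k : ℝ) * stepLen c σ N) z) q then (1 : ℝ) else 0 with hFD
  set FI : Phase N → ℝ := fun z => unitAvg c σ N τ fun k q =>
    if (pop c σ N (Φ.flow ((k : ℝ) * stepLen c σ N) z) q).Nonempty ∧
      ϑh < inhom ϑs (Φ.flow ((k : ℝ) * stepLen c σ N) z) (pop c σ N (Φ.flow ((k : ℝ) * stepLen c σ N) z) q)
        (nbhd c σ N (Φ.flow ((k : ℝ) * stepLen c σ N) z) q) then (1 : ℝ) else 0 with hFI
  set FC : Phase N → ℝ := fun z => unitAvg c σ N τ fun k q =>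
    if (pop c σ N (Φ.flow ((k : ℝ) * stepLen c σ N) z) q).Nonempty ∧
      (pop c σ N (Φ.flow ((k : ℝ) * stepLen c σ N) z) q).card < m₀ then (1 : ℝ) else 0 with hFC
  have hboxR : ∀ (z : Phase N) (k : ℕ), ∀ q ∉ cellBox (c * meanFreePath σ N),
      (if Regular ϑs ϑh φs c σ N (Φ.flow ((k : ℝ) * stepLen c σ N) z) q ∧
        m₀ ≤ (pop c σ N (Φ.flow ((k : ℝ) * stepLen c σ N) z) q).card ∧
        ϑ ≤ relEntAt ϑs c σ N Φ ((k : ℝ) * stepLen c σ N) q z then (1 : ℝ) else 0) = 0 := by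
    intro z k q hq
    rw [if_neg]
    rintro ⟨-, -, hle⟩
    rw [relEntAt_eq_zero_of_not_mem h0 ϑs Φ _ hq] at hle
    exact absurd hle (not_le.2 hϑ)
  have hboxD : ∀ (z : Phase N) (k : ℕ), ∀ q ∉ cellBox (c * meanFreePath σ N),
      (if (pop c σ N (Φ.flow ((k : ℝ) * stepLen c σ N) z) q).Nonempty ∧
        Dense φs c σ N (Φ.flow ((k : ℝ) * stepLen c σ N) z) q then (1 : ℝ) else 0) = 0 :=
    fun z k q hq => indicator_pop_eq_zero_of_not_mem h0 Φ
      (fun k q z => Dense φs c σ N (Φ.flow ((k : ℝ) * stepLen c σ N) z) q) z k hq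
  have hboxI : ∀ (z : Phase N) (k : ℕ), ∀ q ∉ cellBox (c * meanFreePath σ N),
      (if (pop c σ N (Φ.flow ((k : ℝ) * stepLen c σ N) z) q).Nonempty ∧
        ϑh < inhom ϑs (Φ.flow ((k : ℝ) * stepLen c σ N) z) (pop c σ N (Φ.flow ((k : ℝ) * stepLen c σ N) z) q)
          (nbhd c σ N (Φ.flow ((k : ℝ) * stepLen c σ N) z) q) then (1 : ℝ) else 0) = 0 :=
    fun z k q hq => indicator_pop_eq_zero_of_not_mem h0 Φ (fun k q z =>
      ϑh < inhom ϑs (Φ.flow ((k : ℝ) * stepLen c σ N) z) (pop c σ N (Φ.flow ((k : ℝ) * stepLen c σ N) z) q)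
        (nbhd c σ N (Φ.flow ((k : ℝ) * stepLen c σ N) z) q)) z k hq
  have hboxF : ∀ (z : Phase N) (k : ℕ), ∀ q ∉ cellBox (c * meanFreePath σ N),
      (if (pop c σ N (Φ.flow ((k : ℝ) * stepLen c σ N) z) q).Nonempty ∧
        (pop c σ N (Φ.flow ((k : ℝ) * stepLen c σ N) z) q).card < m₀ then (1 : ℝ) else 0) = 0 :=
    fun z k q hq => indicator_pop_eq_zero_of_not_mem h0 Φ
      (fun k q z => (pop c σ N (Φ.flow ((k : ℝ) * stepLen c σ N) z) q).card < m₀) z k hq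
  have hboxC : ∀ (z : Phase N) (k : ℕ), ∀ q ∉ cellBox (c * meanFreePath σ N),
      (if (pop c σ N (Φ.flow ((k : ℝ) * stepLen c σ N) z) q).Nonempty ∧
        ϑ < relEntAt ϑs c σ N Φ ((k : ℝ) * stepLen c σ N) q z then (1 : ℝ) else 0) = 0 :=
    fun z k q hq => indicator_pop_eq_zero_of_not_mem h0 Φ
      (fun k q z => ϑ < relEntAt ϑs c σ N Φ ((k : ℝ) * stepLen c σ N) q z) z k hq
  -- box support of the partial sums of the families
  have hboxRD : ∀ (z : Phase N) (k : ℕ), ∀ q ∉ cellBox (c * meanFreePath σ N),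
      (if Regular ϑs ϑh φs c σ N (Φ.flow ((k : ℝ) * stepLen c σ N) z) q ∧
          m₀ ≤ (pop c σ N (Φ.flow ((k : ℝ) * stepLen c σ N) z) q).card ∧
          ϑ ≤ relEntAt ϑs c σ N Φ ((k : ℝ) * stepLen c σ N) q z then (1 : ℝ) else 0) +
        (if (pop c σ N (Φ.flow ((k : ℝ) * stepLen c σ N) z) q).Nonempty ∧
          Dense φs c σ N (Φ.flow ((k : ℝ) * stepLen c σ N) z) q then (1 : ℝ) else 0) = 0 := by
    intro z k q hq
    rw [hboxR z k q hq, hboxD z k q hq, add_zero]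
  have hboxRDI : ∀ (z : Phase N) (k : ℕ), ∀ q ∉ cellBox (c * meanFreePath σ N),
      (if Regular ϑs ϑh φs c σ N (Φ.flow ((k : ℝ) * stepLen c σ N) z) q ∧
          m₀ ≤ (pop c σ N (Φ.flow ((k : ℝ) * stepLen c σ N) z) q).card ∧
          ϑ ≤ relEntAt ϑs c σ N Φ ((k : ℝ) * stepLen c σ N) q z then (1 : ℝ) else 0) +
        (if (pop c σ N (Φ.flow ((k : ℝ) * stepLen c σ N) z) q).Nonempty ∧
          Dense φs c σ N (Φ.flow ((k : ℝ) * stepLen c σ N) z) q then (1 : ℝ) else 0) +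
        (if (pop c σ N (Φ.flow ((k : ℝ) * stepLen c σ N) z) q).Nonempty ∧
          ϑh < inhom ϑs (Φ.flow ((k : ℝ) * stepLen c σ N) z) (pop c σ N (Φ.flow ((k : ℝ) * stepLen c σ N) z) q)
            (nbhd c σ N (Φ.flow ((k : ℝ) * stepLen c σ N) z) q) then (1 : ℝ) else 0) = 0 := by
    intro z k q hq
    rw [hboxRD z k q hq, hboxI z k q hq, add_zero]
  have hboxRDIF : ∀ (z : Phase N) (k : ℕ), ∀ q ∉ cellBox (c * meanFreePath σ N),
      (if Regular ϑs ϑh φs c σ N (Φ.flow ((k : ℝ) * stepLen c σ N) z) q ∧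
          m₀ ≤ (pop c σ N (Φ.flow ((k : ℝ) * stepLen c σ N) z) q).card ∧
          ϑ ≤ relEntAt ϑs c σ N Φ ((k : ℝ) * stepLen c σ N) q z then (1 : ℝ) else 0) +
        (if (pop c σ N (Φ.flow ((k : ℝ) * stepLen c σ N) z) q).Nonempty ∧
          Dense φs c σ N (Φ.flow ((k : ℝ) * stepLen c σ N) z) q then (1 : ℝ) else 0) +
        (if (pop c σ N (Φ.flow ((k : ℝ) * stepLen c σ N) z) q).Nonempty ∧
          ϑh < inhom ϑs (Φ.flow ((k : ℝ) * stepLen c σ N) z) (pop c σ N (Φ.flow ((k : ℝ) * stepLen c σ N) z) q)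
            (nbhd c σ N (Φ.flow ((k : ℝ) * stepLen c σ N) z) q) then (1 : ℝ) else 0) +
        (if (pop c σ N (Φ.flow ((k : ℝ) * stepLen c σ N) z) q).Nonempty ∧
          (pop c σ N (Φ.flow ((k : ℝ) * stepLen c σ N) z) q).card < m₀ then (1 : ℝ) else 0) = 0 := by
    intro z k q hq
    rw [hboxRDI z k q hq, hboxF z k q hq, add_zero]
  -- pointwise split of the unit averages
  have hsplit : ∀ z, (unitAvg c σ N τ fun k q =>
      if (pop c σ N (Φ.flow ((k : ℝ) * stepLen c σ N) z) q).Nonempty ∧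
        ϑ < relEntAt ϑs c σ N Φ ((k : ℝ) * stepLen c σ N) q z then (1 : ℝ) else 0) ≤ FR z + FD z + FI z + FC z := by
    intro z
    rw [hFR, hFD, hFI, hFC]
    simp only
    rw [← unitAvg_add' τ (hboxR z) (hboxD z), ← unitAvg_add' τ (hboxRD z) (hboxI z),
      ← unitAvg_add' τ (hboxRDI z) (hboxF z)]
    refine unitAvg_mono h0.le (hboxC z) (hboxRDIF z) ?_
    intro k q
    exact clmIndicatorFloor_le ϑs ϑ ϑh φs c m₀ _ q _
  have hR0 : ∀ z, 0 ≤ FR z := fun z =>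
    unitAvg_nonneg h0.le (hboxR z) fun k q => by positivity
  have hD0 : ∀ z, 0 ≤ FD z := fun z =>
    unitAvg_nonneg h0.le (hboxD z) fun k q => by positivity
  have hI0 : ∀ z, 0 ≤ FI z := fun z =>
    unitAvg_nonneg h0.le (hboxI z) fun k q => by positivity
  have hC0 : ∀ z, 0 ≤ FC z := fun z =>
    unitAvg_nonneg h0.le (hboxF z) fun k q => by positivity
  have hR27 : ∀ z, FR z ≤ 27 := fun z => by
    have := unitAvg_le_mul_of_le τ zero_le_one h0 h1 (hboxR z) (fun k q => by split_ifs <;> norm_num)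
    linarith
  -- measurability of the regular, the packed and the inhomogeneous families
  have hmR : Measurable FR := by
    refine measurable_unitAvg_indicator τ (fun k q z => Regular ϑs ϑh φs c σ N (Φ.flow ((k : ℝ) * stepLen c σ N) z) q ∧
      m₀ ≤ (pop c σ N (Φ.flow ((k : ℝ) * stepLen c σ N) z) q).card ∧
      ϑ ≤ relEntAt ϑs c σ N Φ ((k : ℝ) * stepLen c σ N) q z) (fun k q => ?_) hboxR
    exact (measurableSet_regular_flow Φ ϑs ϑh φs c _ q).inter
      (((measurableSet_le_card_pop c σ m₀ q).preimage (Φ.measurable_flow _)).inter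
        (measurableSet_le measurable_const (measurable_relEntAt Φ ϑs c _ q)))
  have hmD : Measurable FD := by
    refine measurable_unitAvg_indicator τ (fun k q z => (pop c σ N (Φ.flow ((k : ℝ) * stepLen c σ N) z) q).Nonempty ∧
      Dense φs c σ N (Φ.flow ((k : ℝ) * stepLen c σ N) z) q) (fun k q => ?_) hboxD
    exact ((measurableSet_pop_nonempty c σ q).preimage (Φ.measurable_flow _)).inter
      ((measurableSet_dense φs c σ q).preimage (Φ.measurable_flow _))
  have hmI : Measurable FI := by
    refine measurable_unitAvg_indicator τ (fun k q z => (pop c σ N (Φ.flow ((k : ℝ) * stepLen c σ N) z) q).Nonempty ∧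
      ϑh < inhom ϑs (Φ.flow ((k : ℝ) * stepLen c σ N) z) (pop c σ N (Φ.flow ((k : ℝ) * stepLen c σ N) z) q)
        (nbhd c σ N (Φ.flow ((k : ℝ) * stepLen c σ N) z) q)) (fun k q => ?_) hboxI
    exact ((measurableSet_pop_nonempty c σ q).preimage (Φ.measurable_flow _)).inter
      (measurableSet_lt measurable_const (measurable_inhom_flow Φ ϑs c _ q))
  -- integrate
  have hRint : ∫⁻ z, ENNReal.ofReal (FR z) ∂μ ≤ ENNReal.ofReal (δ' + 27 * ((Real.log 2 + A) / L)) :=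
    lintegral_ofReal_le_of_measure_le_exp μ ν FR hδ' (by norm_num) hR27 hA hL N hν hKL
  calc ∫⁻ z, ENNReal.ofReal (unitAvg c σ N τ fun k q =>
        if (pop c σ N (Φ.flow ((k : ℝ) * stepLen c σ N) z) q).Nonempty ∧
          ϑ < relEntAt ϑs c σ N Φ ((k : ℝ) * stepLen c σ N) q z then (1 : ℝ) else 0) ∂μ
      ≤ ∫⁻ z, ENNReal.ofReal (FR z) + ENNReal.ofReal (FD z) + ENNReal.ofReal (FI z) + ENNReal.ofReal (FC z) ∂μ := by
        refine lintegral_mono fun z => ?_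
        rw [← ENNReal.ofReal_add (hR0 z) (hD0 z), ← ENNReal.ofReal_add (add_nonneg (hR0 z) (hD0 z)) (hI0 z),
          ← ENNReal.ofReal_add (add_nonneg (add_nonneg (hR0 z) (hD0 z)) (hI0 z)) (hC0 z)]
        exact ENNReal.ofReal_le_ofReal (hsplit z)
    _ = (∫⁻ z, ENNReal.ofReal (FR z) ∂μ) + (∫⁻ z, ENNReal.ofReal (FD z) ∂μ) + (∫⁻ z, ENNReal.ofReal (FI z) ∂μ) +
          ∫⁻ z, ENNReal.ofReal (FC z) ∂μ := by
        have hRD : Measurable fun z => ENNReal.ofReal (FR z) + ENNReal.ofReal (FD z) :=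
          hmR.ennreal_ofReal.add hmD.ennreal_ofReal
        have hRDI : Measurable fun z => ENNReal.ofReal (FR z) + ENNReal.ofReal (FD z) + ENNReal.ofReal (FI z) :=
          hRD.add hmI.ennreal_ofReal
        rw [lintegral_add_left hRDI, lintegral_add_left hRD, lintegral_add_left hmR.ennreal_ofReal]
    _ ≤ ENNReal.ofReal (δ' + 27 * ((Real.log 2 + A) / L)) + δ₁ + δ₂ + δ₃ := by
        gcongr

end Summit.AtomisticToContinuum.HydrodynamicLimit.Theorems.EquilibriumForecastLine

end
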